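import Summits.Ventures.PercRepro.Night2SeriesClasses
import Summits.Ventures.PercRepro.Night2SeriesTriangle

/-!
# PercRepro — the series-class count of the COVERING BASES (night-2, gen 23)

**`card_coverBases_le_cntSeries`**: for pairwise disjoint nonempty classes every pair of which is a 2-cocircuit
(`G ∖ {a, b} ⊇ K` of rank `≤ q`), a covering basis misses at most one point of each class
(`coverBases_subset_seriesFamily`), hence `#coverBases(S) ≤ cntSeries ρ |S ∖ K| (sizes)` by `card_seriesFamily_le`.
-/

namespace PercRepro.Shadow

open Finset PerFlat ThmH

variable {α : Type*} [DecidableEq α] {M : Matroid α} [M.Finite]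

open scoped Classical in
/-- **The covering bases lie in the series family**: if every pair of every class is a 2-cocircuit (`G ∖ {a, b} ⊇ K`
of rank `≤ q`), a covering basis misses at most one point of each class. -/
theorem coverBases_subset_seriesFamily {q ρ : ℕ} {G : Finset α} (hk : kColoops M G + ρ = q + 1)
    (Cs : List (Finset α))
    (hcoc : ∀ C ∈ Cs, ∀ a ∈ C, ∀ b ∈ C, a ≠ b →
      coloops M G ⊆ G \ {a, b} ∧ M.eRk ((G \ {a, b} : Finset α) : Set α) ≤ (q : ℕ∞))
    {S : Finset α} (hSG : S ⊆ G) :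
    coverBases M G S ρ ⊆ seriesFamily (S \ coloops M G) ρ Cs := by
  intro T hT
  have hT' := hT
  unfold coverBases at hT'
  rw [Finset.mem_filter] at hT'
  obtain ⟨hTp, hind⟩ := hT'
  rw [Finset.mem_powersetCard] at hTp
  rw [mem_seriesFamily]
  refine ⟨hTp, ?_⟩
  intro C hC
  by_contra hmiss
  push Not at hmiss
  obtain ⟨a, ha, b, hb, hab⟩ := Finset.one_lt_card.1 hmiss
  rw [Finset.mem_sdiff] at ha hb
  obtain ⟨hKab, hHab⟩ := hcoc C hC a ha.1 b hb.1 hab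
  have hTK : Disjoint (coloops M G) T := by
    rw [Finset.disjoint_left]
    intro w hw hwT
    exact (Finset.mem_sdiff.1 (hTp.1 hwT)).2 hw
  have hcard : (coloops M G ∪ T).card = q + 1 := by
    rw [Finset.card_union_of_disjoint hTK, ← kColoops_eq_card_coloops, hTp.2, hk]
  have hKT : ((coloops M G ∪ T : Finset α) : Set α) ⊆ ((G \ {a, b} : Finset α) : Set α) := by
    rw [Finset.coe_subset]
    apply Finset.union_subset hKab
    intro w hw
    rw [Finset.mem_sdiff]
    refine ⟨hSG (Finset.mem_sdiff.1 (hTp.1 hw)).1, ?_⟩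
    simp only [Finset.mem_insert, Finset.mem_singleton]
    rintro (rfl | rfl)
    · exact ha.2 hw
    · exact hb.2 hw
  have h1 := hind.encard_le_eRk_of_subset hKT
  rw [Set.encard_coe_eq_coe_finsetCard, hcard] at h1
  have h2 : ((q + 1 : ℕ) : ℕ∞) ≤ (q : ℕ∞) := h1.trans hHab
  have h3 : q + 1 ≤ q := by exact_mod_cast h2
  omega

open scoped Classical in
/-- **THE SERIES-CLASS COUNT OF THE COVERING BASES**: pairwise disjoint nonempty classes whose pairs are 2-cocircuits
bound `#coverBases(S)` by `cntSeries ρ |S ∖ K| (sizes)`. -/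
theorem card_coverBases_le_cntSeries {q ρ : ℕ} {G : Finset α} (hk : kColoops M G + ρ = q + 1)
    (Cs : List (Finset α)) (hpw : Cs.Pairwise Disjoint) (hsz : ∀ C ∈ Cs, 1 ≤ C.card)
    (hcoc : ∀ C ∈ Cs, ∀ a ∈ C, ∀ b ∈ C, a ≠ b →
      coloops M G ⊆ G \ {a, b} ∧ M.eRk ((G \ {a, b} : Finset α) : Set α) ≤ (q : ℕ∞))
    {S : Finset α} (hSG : S ⊆ G) :
    ((coverBases M G S ρ).card : ℚ) ≤ (cntSeries ρ (S \ coloops M G).card (Cs.map Finset.card) : ℚ) := by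
  have h1 := Finset.card_le_card (coverBases_subset_seriesFamily hk Cs hcoc hSG)
  have h2 := card_seriesFamily_le Cs (S \ coloops M G) ρ hpw hsz
  exact_mod_cast h1.trans h2

end PercRepro.Shadow
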